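import Mathlib.Tactic
import HarnessLib

/-!
# R-W WINDOW-TABLE, W1 ROWS 6–8 UNCONDITIONAL — the symbolic integer cells: (A) the triple `283 + 5¹¹·13² = 2⁸·3⁸·17³` at `l = 283` (row 8)

PROOF-ONLY file (D-0012; 0 definitions, 0 `Prop` facts; pure integer arithmetic) of the abc-iut cell — D-0079 RESCUE sub-cell R-W «WINDOW Θ-SIDE
INEQUALITY», W1 ROW DECISIONS seat abc-iut-W-row-2 (gen 2), rows 6–8 of HOME/plan/rescue/R-W/OPEN-10.md (sha16 1b0025ee7a8ba6d7). The licence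
socket's integer cells `e·⌊(j²P − j·D − (j+1)·ρin)/e⌋ + (j+1)·ρout ≤ P` (`P = e·h/(2l)`, abc-iut-w4-d036's exact cell p460046/p460573 in the orders
form of `Cor312Prov.licence_settingPrVolSharp_pilotDataOfK_of_orders_rat`) for EVERY admissible ramification index `e = e₀·n`, `n ≥ 1`, at every
label `j = i + 1 ≤ l⋆` (`l⋆ = 141, 36, 63`), with the one-sided data `D = 2e − 1`, `ρin = e/(p−1)` at the wild primes `3, 5` and `D = e − 1`,
`ρin = 1` at the tame poles, `ρout = min(p^a − a·e, p^b − b·e)` (statement shape of abc-iut-W-row-1's `WRowUnconditionalCellsA/B`). PROOF without a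
case split over the labels: after `Int.mul_ediv_self_le` and `ρout ≤ p^a − a·e` the no-floor form is `F(i,n) = n·Q(i) + L(i)` with `Q` a convex
quadratic in `i` (leading coefficient `P/n > 0`) and `L(i) = (i+1) + (i+2)·p^a > 0` (tame; wild: `L = (i+1) + (i+2)·p^a` likewise), so `F ≤ 0` on
`[0, l⋆−1] × [1, ∞)` follows from the four corner numbers `F(0,1), F(l⋆−1,1), Q(0), Q(l⋆−1) ≤ 0`; `linarith`/`nlinarith` is handed the three products
`(n−1)·i`, `(n−1)·(l⋆−1−i)`, `n·i·(l⋆−1−i) ≥ 0`. Desk check (session folder work/ucells.py, exact integer arithmetic): every cell holds exactly for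
`n ≤ 1500` at the extreme labels and `n ≤ 50` at all labels, and the four corner numbers are negative for all 14 (row, prime) pairs (worst exact
margins: row 8 — 148428 @3, 224110 @5, 25351 @13, 6512 @17; row 6 — 33336 @3, 7084 @7, 904 @103, 3046 @127, 1433 @941; row 7 — 60876 @3,
12754 @7, 5584 @73, 1714 @103, 3863 @941; always at `j = 1`, `n = 1`). Consumers: the row files `AbcOfSGenuineKWildInhabitedRow283Unconditional.lean`,
`…Row73Unconditional.lean`, `…Row73L127Unconditional.lean`. HONEST SCOPE: integer arithmetic only; nothing here bears on the printed inequality; no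
abc claim. [folklore]
-/

namespace Summit.ABC.IUTFork.Conditional

/-! ## The cells at `l = 283` (row 8) -/

/-- **Cells over `3` for the row `frey283@283`, every `e = 8490·n`** (`n ≥ 1`; `P = 240n`, `D = 2e − 1`, `ρin = e/2`,
`ρout = min(3^8 − 8e, 3^9 − 9e)`): the socket's integer cell at every label `j = i + 1 ≤ 141` (floor dropped; the no-floor form is
`n·Q(i) + L(i)`, `Q` convex in `i`, `L > 0` — certificate from the corner values). [folklore] -/
theorem WRow.ucell_frey283_l283_p3 {n : ℕ} (hn : 1 ≤ n) (i : ℕ) (hi : i < 141) :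
    ((8490 * n : ℕ) : ℤ) *
          (((((i + 1 : ℕ) : ℤ) ^ 2 * ((8490 * n * 16 / (2 * 283) : ℕ) : ℤ) - ((i + 1 : ℕ) : ℤ) * ((2 * (8490 * n) - 1 : ℕ) : ℤ) -
              ((i + 2 : ℕ) : ℤ) * (((8490 * n / 2 : ℕ) : ℤ)))) / ((8490 * n : ℕ) : ℤ)) +
        ((i + 2 : ℕ) : ℤ) * min ((3 : ℤ) ^ 8 - 8 * ((8490 * n : ℕ) : ℤ)) ((3 : ℤ) ^ 9 - 9 * ((8490 * n : ℕ) : ℤ)) ≤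
      ((8490 * n * 16 / (2 * 283) : ℕ) : ℤ) := by
  have he0 : (0 : ℤ) < ((8490 * n : ℕ) : ℤ) := by positivity
  have hP : (8490 * n * 16 / (2 * 283) : ℕ) = 240 * n := by omega
  have hfloor := Int.mul_ediv_self_le (k := ((8490 * n : ℕ) : ℤ))
    (x := (((i + 1 : ℕ) : ℤ) ^ 2 * ((8490 * n * 16 / (2 * 283) : ℕ) : ℤ) - ((i + 1 : ℕ) : ℤ) * ((2 * (8490 * n) - 1 : ℕ) : ℤ) -
              ((i + 2 : ℕ) : ℤ) * (((8490 * n / 2 : ℕ) : ℤ)))) he0.ne'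
  have hsub : ((2 * (8490 * n) - 1 : ℕ) : ℤ) = 2 * (8490 * (n : ℤ)) - 1 := by
    rw [Nat.cast_sub (by omega)]; push_cast; ring
  have hR : (8490 * n / 2 : ℕ) = 4245 * n := by omega
  rw [hsub, hP, hR] at hfloor ⊢
  have hmin : min ((3 : ℤ) ^ 8 - 8 * ((8490 * n : ℕ) : ℤ)) ((3 : ℤ) ^ 9 - 9 * ((8490 * n : ℕ) : ℤ)) ≤ (6561 : ℤ) - 8 * (8490 * (n : ℤ)) :=
    (min_le_left _ _).trans (by push_cast; exact le_rfl)
  generalize min ((3 : ℤ) ^ 8 - 8 * ((8490 * n : ℕ) : ℤ)) ((3 : ℤ) ^ 9 - 9 * ((8490 * n : ℕ) : ℤ)) = ρ at hmin ⊢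
  have hi0 : (0 : ℤ) ≤ (i : ℤ) := by positivity
  have hiL : (i : ℤ) ≤ 140 := by exact_mod_cast (by omega : i ≤ 140)
  have hn1 : (1 : ℤ) ≤ (n : ℤ) := by exact_mod_cast hn
  have hρ := mul_le_mul_of_nonneg_left hmin (show (0 : ℤ) ≤ ((i + 2 : ℕ) : ℤ) by positivity)
  have h1 : 0 ≤ ((n : ℤ) - 1) * (i : ℤ) := mul_nonneg (by linarith) hi0
  have h2 : 0 ≤ ((n : ℤ) - 1) * (140 - (i : ℤ)) := mul_nonneg (by linarith) (by linarith)
  have h3 : 0 ≤ (n : ℤ) * ((i : ℤ) * (140 - (i : ℤ))) := mul_nonneg (by linarith) (mul_nonneg hi0 (by linarith))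
  push_cast at hfloor hρ ⊢
  linarith

/-- **Cells over `5` for the row `frey283@283`, every `e = 16980·n`** (`n ≥ 1`; `P = 660n`, `D = 2e − 1`, `ρin = e/4`,
`ρout = min(5^6 − 6e, 5^7 − 7e)`): the socket's integer cell at every label `j = i + 1 ≤ 141` (floor dropped; the no-floor form is
`n·Q(i) + L(i)`, `Q` convex in `i`, `L > 0` — certificate from the corner values). [folklore] -/
theorem WRow.ucell_frey283_l283_p5 {n : ℕ} (hn : 1 ≤ n) (i : ℕ) (hi : i < 141) :
    ((16980 * n : ℕ) : ℤ) *
          (((((i + 1 : ℕ) : ℤ) ^ 2 * ((16980 * n * 22 / (2 * 283) : ℕ) : ℤ) - ((i + 1 : ℕ) : ℤ) * ((2 * (16980 * n) - 1 : ℕ) : ℤ) -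
              ((i + 2 : ℕ) : ℤ) * (((16980 * n / 4 : ℕ) : ℤ)))) / ((16980 * n : ℕ) : ℤ)) +
        ((i + 2 : ℕ) : ℤ) * min ((5 : ℤ) ^ 6 - 6 * ((16980 * n : ℕ) : ℤ)) ((5 : ℤ) ^ 7 - 7 * ((16980 * n : ℕ) : ℤ)) ≤
      ((16980 * n * 22 / (2 * 283) : ℕ) : ℤ) := by
  have he0 : (0 : ℤ) < ((16980 * n : ℕ) : ℤ) := by positivity
  have hP : (16980 * n * 22 / (2 * 283) : ℕ) = 660 * n := by omega
  have hfloor := Int.mul_ediv_self_le (k := ((16980 * n : ℕ) : ℤ))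
    (x := (((i + 1 : ℕ) : ℤ) ^ 2 * ((16980 * n * 22 / (2 * 283) : ℕ) : ℤ) - ((i + 1 : ℕ) : ℤ) * ((2 * (16980 * n) - 1 : ℕ) : ℤ) -
              ((i + 2 : ℕ) : ℤ) * (((16980 * n / 4 : ℕ) : ℤ)))) he0.ne'
  have hsub : ((2 * (16980 * n) - 1 : ℕ) : ℤ) = 2 * (16980 * (n : ℤ)) - 1 := by
    rw [Nat.cast_sub (by omega)]; push_cast; ring
  have hR : (16980 * n / 4 : ℕ) = 4245 * n := by omega
  rw [hsub, hP, hR] at hfloor ⊢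
  have hmin : min ((5 : ℤ) ^ 6 - 6 * ((16980 * n : ℕ) : ℤ)) ((5 : ℤ) ^ 7 - 7 * ((16980 * n : ℕ) : ℤ)) ≤ (15625 : ℤ) - 6 * (16980 * (n : ℤ)) :=
    (min_le_left _ _).trans (by push_cast; exact le_rfl)
  generalize min ((5 : ℤ) ^ 6 - 6 * ((16980 * n : ℕ) : ℤ)) ((5 : ℤ) ^ 7 - 7 * ((16980 * n : ℕ) : ℤ)) = ρ at hmin ⊢
  have hi0 : (0 : ℤ) ≤ (i : ℤ) := by positivity
  have hiL : (i : ℤ) ≤ 140 := by exact_mod_cast (by omega : i ≤ 140)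
  have hn1 : (1 : ℤ) ≤ (n : ℤ) := by exact_mod_cast hn
  have hρ := mul_le_mul_of_nonneg_left hmin (show (0 : ℤ) ≤ ((i + 2 : ℕ) : ℤ) by positivity)
  have h1 : 0 ≤ ((n : ℤ) - 1) * (i : ℤ) := mul_nonneg (by linarith) hi0
  have h2 : 0 ≤ ((n : ℤ) - 1) * (140 - (i : ℤ)) := mul_nonneg (by linarith) (by linarith)
  have h3 : 0 ≤ (n : ℤ) * ((i : ℤ) * (140 - (i : ℤ))) := mul_nonneg (by linarith) (mul_nonneg hi0 (by linarith))
  push_cast at hfloor hρ ⊢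
  linarith

/-- **Cells over `13` for the row `frey283@283`, every `e = 4245·n`** (`n ≥ 1`; `P = 30n`, `D = e − 1`, `ρin = 1`,
`ρout = min(13^3 − 3e, 13^4 − 4e)`): the socket's integer cell at every label `j = i + 1 ≤ 141` (floor dropped; the no-floor form is
`n·Q(i) + L(i)`, `Q` convex in `i`, `L > 0` — certificate from the corner values). [folklore] -/
theorem WRow.ucell_frey283_l283_p13 {n : ℕ} (hn : 1 ≤ n) (i : ℕ) (hi : i < 141) :
    ((4245 * n : ℕ) : ℤ) *
          (((((i + 1 : ℕ) : ℤ) ^ 2 * ((4245 * n * 4 / (2 * 283) : ℕ) : ℤ) - ((i + 1 : ℕ) : ℤ) * ((4245 * n - 1 : ℕ) : ℤ) -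
              ((i + 2 : ℕ) : ℤ) * (1 : ℤ))) / ((4245 * n : ℕ) : ℤ)) +
        ((i + 2 : ℕ) : ℤ) * min ((13 : ℤ) ^ 3 - 3 * ((4245 * n : ℕ) : ℤ)) ((13 : ℤ) ^ 4 - 4 * ((4245 * n : ℕ) : ℤ)) ≤
      ((4245 * n * 4 / (2 * 283) : ℕ) : ℤ) := by
  have he0 : (0 : ℤ) < ((4245 * n : ℕ) : ℤ) := by positivity
  have hP : (4245 * n * 4 / (2 * 283) : ℕ) = 30 * n := by omega
  have hfloor := Int.mul_ediv_self_le (k := ((4245 * n : ℕ) : ℤ))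
    (x := (((i + 1 : ℕ) : ℤ) ^ 2 * ((4245 * n * 4 / (2 * 283) : ℕ) : ℤ) - ((i + 1 : ℕ) : ℤ) * ((4245 * n - 1 : ℕ) : ℤ) -
              ((i + 2 : ℕ) : ℤ) * (1 : ℤ))) he0.ne'
  have hsub : ((4245 * n - 1 : ℕ) : ℤ) = 4245 * (n : ℤ) - 1 := by
    rw [Nat.cast_sub (by omega)]; push_cast; ring
  rw [hsub, hP] at hfloor ⊢
  have hmin : min ((13 : ℤ) ^ 3 - 3 * ((4245 * n : ℕ) : ℤ)) ((13 : ℤ) ^ 4 - 4 * ((4245 * n : ℕ) : ℤ)) ≤ (2197 : ℤ) - 3 * (4245 * (n : ℤ)) :=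
    (min_le_left _ _).trans (by push_cast; exact le_rfl)
  generalize min ((13 : ℤ) ^ 3 - 3 * ((4245 * n : ℕ) : ℤ)) ((13 : ℤ) ^ 4 - 4 * ((4245 * n : ℕ) : ℤ)) = ρ at hmin ⊢
  have hi0 : (0 : ℤ) ≤ (i : ℤ) := by positivity
  have hiL : (i : ℤ) ≤ 140 := by exact_mod_cast (by omega : i ≤ 140)
  have hn1 : (1 : ℤ) ≤ (n : ℤ) := by exact_mod_cast hn
  have hρ := mul_le_mul_of_nonneg_left hmin (show (0 : ℤ) ≤ ((i + 2 : ℕ) : ℤ) by positivity)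
  have h1 : 0 ≤ ((n : ℤ) - 1) * (i : ℤ) := mul_nonneg (by linarith) hi0
  have h2 : 0 ≤ ((n : ℤ) - 1) * (140 - (i : ℤ)) := mul_nonneg (by linarith) (by linarith)
  have h3 : 0 ≤ (n : ℤ) * ((i : ℤ) * (140 - (i : ℤ))) := mul_nonneg (by linarith) (mul_nonneg hi0 (by linarith))
  push_cast at hfloor hρ ⊢
  linarith

/-- **Cells over `17` for the row `frey283@283`, every `e = 1415·n`** (`n ≥ 1`; `P = 15n`, `D = e − 1`, `ρin = 1`,
`ρout = min(17^2 − 2e, 17^3 − 3e)`): the socket's integer cell at every label `j = i + 1 ≤ 141` (floor dropped; the no-floor form is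
`n·Q(i) + L(i)`, `Q` convex in `i`, `L > 0` — certificate from the corner values). [folklore] -/
theorem WRow.ucell_frey283_l283_p17 {n : ℕ} (hn : 1 ≤ n) (i : ℕ) (hi : i < 141) :
    ((1415 * n : ℕ) : ℤ) *
          (((((i + 1 : ℕ) : ℤ) ^ 2 * ((1415 * n * 6 / (2 * 283) : ℕ) : ℤ) - ((i + 1 : ℕ) : ℤ) * ((1415 * n - 1 : ℕ) : ℤ) -
              ((i + 2 : ℕ) : ℤ) * (1 : ℤ))) / ((1415 * n : ℕ) : ℤ)) +
        ((i + 2 : ℕ) : ℤ) * min ((17 : ℤ) ^ 2 - 2 * ((1415 * n : ℕ) : ℤ)) ((17 : ℤ) ^ 3 - 3 * ((1415 * n : ℕ) : ℤ)) ≤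
      ((1415 * n * 6 / (2 * 283) : ℕ) : ℤ) := by
  have he0 : (0 : ℤ) < ((1415 * n : ℕ) : ℤ) := by positivity
  have hP : (1415 * n * 6 / (2 * 283) : ℕ) = 15 * n := by omega
  have hfloor := Int.mul_ediv_self_le (k := ((1415 * n : ℕ) : ℤ))
    (x := (((i + 1 : ℕ) : ℤ) ^ 2 * ((1415 * n * 6 / (2 * 283) : ℕ) : ℤ) - ((i + 1 : ℕ) : ℤ) * ((1415 * n - 1 : ℕ) : ℤ) -
              ((i + 2 : ℕ) : ℤ) * (1 : ℤ))) he0.ne'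
  have hsub : ((1415 * n - 1 : ℕ) : ℤ) = 1415 * (n : ℤ) - 1 := by
    rw [Nat.cast_sub (by omega)]; push_cast; ring
  rw [hsub, hP] at hfloor ⊢
  have hmin : min ((17 : ℤ) ^ 2 - 2 * ((1415 * n : ℕ) : ℤ)) ((17 : ℤ) ^ 3 - 3 * ((1415 * n : ℕ) : ℤ)) ≤ (289 : ℤ) - 2 * (1415 * (n : ℤ)) :=
    (min_le_left _ _).trans (by push_cast; exact le_rfl)
  generalize min ((17 : ℤ) ^ 2 - 2 * ((1415 * n : ℕ) : ℤ)) ((17 : ℤ) ^ 3 - 3 * ((1415 * n : ℕ) : ℤ)) = ρ at hmin ⊢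
  have hi0 : (0 : ℤ) ≤ (i : ℤ) := by positivity
  have hiL : (i : ℤ) ≤ 140 := by exact_mod_cast (by omega : i ≤ 140)
  have hn1 : (1 : ℤ) ≤ (n : ℤ) := by exact_mod_cast hn
  have hρ := mul_le_mul_of_nonneg_left hmin (show (0 : ℤ) ≤ ((i + 2 : ℕ) : ℤ) by positivity)
  have h1 : 0 ≤ ((n : ℤ) - 1) * (i : ℤ) := mul_nonneg (by linarith) hi0
  have h2 : 0 ≤ ((n : ℤ) - 1) * (140 - (i : ℤ)) := mul_nonneg (by linarith) (by linarith)
  have h3 : 0 ≤ (n : ℤ) * ((i : ℤ) * (140 - (i : ℤ))) := mul_nonneg (by linarith) (mul_nonneg hi0 (by linarith))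
  push_cast at hfloor hρ ⊢
  linarith

end Summit.ABC.IUTFork.Conditional
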